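import Summits.SmoothPoincare4.SmoothPoincare4.Theses.DottedCircleRasmussen
import Summits.SmoothPoincare4.SmoothPoincare4.Theorems.DottedCircleRasmussenDcrTransport

/-!
# The `k = 1` rung `DcrGapOne`: its exact logical position (support for stmt-SmoothPoincare4-16129)

Route `SmoothPoincare4/DottedCircleRasmussen`, support item stmt-SmoothPoincare4-16129, decl
`Summit.SmoothPoincare4.SmoothPoincare4.Theses.DottedCircleRasmussen.DcrGapOne` (the ONE-HANDLE
SLICE GAP with one dotted circle): there are a smoothly embedded model circle `K₀ ⊂ ∂D_1 ≅ S¹ × S²`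
(`D_1 ⊂ ℝ⁴` the dotted picture of a `0`-handle and one `1`-handle, `≅ S¹ × B³`), a smooth homotopy
`4`-sphere `Σ` with a smooth chart `e : ℝ⁴ ↪ Σ` and a smooth proper disc in `Σ ∖ e(D_1)` bounded by
`e ∘ K₀`, while NO smooth `N ≅ S⁴` carries such a datum `(e', f')`.

The statement is OPEN as filed (planner tag `[difficulty: open-problem]`). This file records, as
sorry-free theorems over the tree, exactly where it sits; nothing here concludes the item (it is
`--supports` material, in the format of `Theorems/ZeroSurgeryExoticZseHsliceNotSlicePosition.lean`):

* **vocabulary** — the item is word for word the `r = 1` instance of the Literature model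
  (`MMSW.IsModelKnot 1`, `MMSW.IsSliceDiscInComplement 1`): `iff_model` (`Iff.rfl`);
* **above it** — the rung implies the route target `DcrGap` (instantiation `k := 1`, the term
  `⟨1, h⟩`; as a named statement this is the glue item `DcrRungGlue`, stmt-SmoothPoincare4-16120,
  not closed here), hence refutes the summit (`not_smoothPoincare4`, through the route's certified
  `closes`); every witness `Σ` is an exotic `4`-sphere (`isEmpty_diffeomorph_of_witness`,
  `exists_exotic`): a Lean proof of the item is a Lean disproof of `SmoothPoincare4`;
* **its negation** — `SmoothPoincare4` refutes it (`not_of_smoothPoincare4`), as does the kill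
  switch `DcrRigidity = ¬ DcrGap` (`not_of_dcrRigidity`); unfolded, `¬ DcrGapOne` is the `k = 1`
  RIGIDITY statement "a model knot in `S¹ × S²` sliceable in some homotopy sphere's
  `D_1`-complement is sliceable in the standard one" (`not_iff_rigidityOne`) — itself open: for
  knots local in a `3`-ball of `∂D_1` it is "slice in a homotopy `4`-ball ⇒ slice in `B⁴`", i.e.
  the negation of the FGMW waypoint `ZeroSurgeryExotic.ZseHsliceNotSlice`
  (stmt-SmoothPoincare4-0520), by the capping / Palais argument recorded in the item's evidence
  note (not formalised here);
* **sharpening** — in the no-disc clause the literal unit sphere `S⁴ ⊂ ℝ⁵` suffices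
  (`noDisc_iff_sphere`, by the PROVED transport support `DcrTransport_proof` and
  `Diffeomorph.refl`), whence the working form `iff_sphereForm` that a certificate attempt (engine
  `DcrRasmussenWitness` at `k = 1` + the GFGMW window) would have to instantiate.

No definitions, no named facts, no `sorry`.

## References

* M. Freedman, R. Gompf, S. Morrison, K. Walker, *Man and machine thinking about the smooth
  4-dimensional Poincaré conjecture*, Quantum Topol. 1 (2010), §1
  [FreedmanGompfMorrisonWalker2010].
* C. Manolescu, M. Marengon, S. Sarkar, M. Willis, *A generalization of Rasmussen's invariant,
  with applications to surfaces in some four-manifolds*, Duke Math. J. 172 (2023), Thms. 1.6–1.7,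
  Lemma 8.19, Question 9.11 [ManolescuMarengonSarkarWillis2023].
* R. Palais, *Extending diffeomorphisms*, Proc. AMS 11 (1960), Thm. B [Palais1960].
-/

noncomputable section

-- the prescribed namespace `Summit.<P>.<Sub>.…` duplicates `SmoothPoincare4` (P = Sub)
set_option linter.dupNamespace false

open scoped Manifold ContDiff
open ContinuousMap
open Literature.Topology.FourManifolds

namespace Summit.SmoothPoincare4.SmoothPoincare4.Theorems.DcrGapOne

open Summit.SmoothPoincare4.SmoothPoincare4.Theses.DottedCircleRasmussen

/-! ### Vocabulary -/

/-- **The item in the Literature model vocabulary.** `DcrGapOne` is, word for word, the statement: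
some model knot `K` in `M_1 = ∂D_1` (`MMSW.IsModelKnot 1 K`) has a slice-disc datum in the
`D_1`-complement of some smooth homotopy `4`-sphere (`MMSW.IsSliceDiscInComplement 1 K M e f`) and
none in any smooth `N ≅ S⁴`. Definitional (`Iff.rfl`). [folklore] -/
theorem iff_model :
    DcrGapOne ↔
      ∃ K : Metric.sphere (0 : EuclideanSpace ℝ (Fin 2)) 1 → EuclideanSpace ℝ (Fin 4),
        MMSW.IsModelKnot 1 K ∧
        (∃ (M : Type) (_ : TopologicalSpace M) (_ : T2Space M) (_ : SecondCountableTopology M)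
            (_ : ChartedSpace (EuclideanSpace ℝ (Fin 4)) M) (_ : IsManifold (𝓡 4) ∞ M),
            Nonempty (M ≃ₕ Metric.sphere (0 : EuclideanSpace ℝ (Fin 5)) 1) ∧
              ∃ (e : EuclideanSpace ℝ (Fin 4) → M) (f : EuclideanSpace ℝ (Fin 2) → M),
                MMSW.IsSliceDiscInComplement 1 K M e f) ∧
        ∀ (N : Type) [TopologicalSpace N] [T2Space N] [SecondCountableTopology N]
          [ChartedSpace (EuclideanSpace ℝ (Fin 4)) N] [IsManifold (𝓡 4) ∞ N],
          Nonempty (N ≃ₘ⟮𝓡 4, 𝓡 4⟯ Metric.sphere (0 : EuclideanSpace ℝ (Fin 5)) 1) →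
          ∀ (e' : EuclideanSpace ℝ (Fin 4) → N) (f' : EuclideanSpace ℝ (Fin 2) → N),
            ¬ MMSW.IsSliceDiscInComplement 1 K N e' f' :=
  Iff.rfl

/-! ### Above the item -/

/-- **The rung refutes the summit**: `DcrGapOne → DcrGap` is the instantiation `k := 1` (the term
`⟨1, h⟩`; as a named theorem this is the glue item `DcrRungGlue`, stmt-SmoothPoincare4-16120, left
to its own seat), and `DcrGap` refutes `SmoothPoincare4` by the route's certified deciding theorem
`closes` (`SmoothPoincare4` makes the witnessing homotopy sphere an admissible `N ≅ S⁴`). Hence a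
proof of the item is a disproof of `SmoothPoincare4`. [cite: FreedmanGompfMorrisonWalker2010, §1] -/
theorem not_smoothPoincare4 (h : DcrGapOne) : ¬ _root_.SmoothPoincare4 :=
  closes ⟨1, h⟩

/-- **Every witness is exotic**: if `(e, f)` is a slice datum for the model knot `K` in the
`D_1`-complement of `M` and no smooth `N ≅ S⁴` carries one, then `M` is not diffeomorphic to `S⁴`
(take `N := M`). [cite: FreedmanGompfMorrisonWalker2010, §1] -/
theorem isEmpty_diffeomorph_of_witness
    {K : Metric.sphere (0 : EuclideanSpace ℝ (Fin 2)) 1 → EuclideanSpace ℝ (Fin 4)} {M : Type}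
    [TopologicalSpace M] [T2Space M] [SecondCountableTopology M]
    [ChartedSpace (EuclideanSpace ℝ (Fin 4)) M] [IsManifold (𝓡 4) ∞ M]
    {e : EuclideanSpace ℝ (Fin 4) → M} {f : EuclideanSpace ℝ (Fin 2) → M}
    (hA : MMSW.IsSliceDiscInComplement 1 K M e f)
    (hB : ∀ (N : Type) [TopologicalSpace N] [T2Space N] [SecondCountableTopology N]
        [ChartedSpace (EuclideanSpace ℝ (Fin 4)) N] [IsManifold (𝓡 4) ∞ N],
        Nonempty (N ≃ₘ⟮𝓡 4, 𝓡 4⟯ Metric.sphere (0 : EuclideanSpace ℝ (Fin 5)) 1) →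
        ∀ (e' : EuclideanSpace ℝ (Fin 4) → N) (f' : EuclideanSpace ℝ (Fin 2) → N),
          ¬ MMSW.IsSliceDiscInComplement 1 K N e' f') :
    IsEmpty (M ≃ₘ⟮𝓡 4, 𝓡 4⟯ Metric.sphere (0 : EuclideanSpace ℝ (Fin 5)) 1) :=
  ⟨fun Φ ↦ hB M ⟨Φ⟩ e f hA⟩

/-- **The rung yields an exotic `4`-sphere**: a smooth `4`-manifold (Statement binders) homotopy
equivalent but not diffeomorphic to `S⁴` — namely the witnessing `Σ`.
[cite: FreedmanGompfMorrisonWalker2010, §1] -/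
theorem exists_exotic (h : DcrGapOne) :
    ∃ (M : Type) (_ : TopologicalSpace M) (_ : T2Space M) (_ : SecondCountableTopology M)
      (_ : ChartedSpace (EuclideanSpace ℝ (Fin 4)) M) (_ : IsManifold (𝓡 4) ∞ M),
      Nonempty (M ≃ₕ Metric.sphere (0 : EuclideanSpace ℝ (Fin 5)) 1) ∧
        IsEmpty (M ≃ₘ⟮𝓡 4, 𝓡 4⟯ Metric.sphere (0 : EuclideanSpace ℝ (Fin 5)) 1) := by
  obtain ⟨K, -, ⟨M, _, _, _, _, _, hM, e, f, hA⟩, hB⟩ := iff_model.1 h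
  exact ⟨M, _, ‹_›, ‹_›, _, ‹_›, hM, isEmpty_diffeomorph_of_witness hA hB⟩

/-! ### The negation -/

/-- **`SmoothPoincare4` refutes the rung** (contrapositive of `not_smoothPoincare4`): a refutation
of the item is at most SPC4-hard. [cite: FreedmanGompfMorrisonWalker2010, §1] -/
theorem not_of_smoothPoincare4 (hS : _root_.SmoothPoincare4) : ¬ DcrGapOne :=
  fun h ↦ closes ⟨1, h⟩ hS

/-- **The kill switch refutes the rung**: `DcrRigidity` is `¬ DcrGap` by name, and the rung implies
`DcrGap`. [folklore] -/
theorem not_of_dcrRigidity (hR : DcrRigidity) : ¬ DcrGapOne :=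
  fun h ↦ hR ⟨1, h⟩

/-! ### Sharpening: the literal `S⁴` suffices in the no-disc clause -/

/-- **No-disc clause: the literal unit sphere suffices.** For a model knot `K`, "no smooth `N ≅ S⁴`
carries a slice datum for `K` in its `D_1`-complement" is equivalent to "the unit sphere `S⁴ ⊂ ℝ⁵`
(with Mathlib's atlas) carries none": `→` by `N := S⁴`, `Diffeomorph.refl`; `←` by transport of a
datum along `Φ : N ≃ₘ S⁴` (the PROVED support `DcrTransport_proof`, `k := 1`).
[cite: Palais1960, Thm. B] -/
theorem noDisc_iff_sphere
    (K : Metric.sphere (0 : EuclideanSpace ℝ (Fin 2)) 1 → EuclideanSpace ℝ (Fin 4)) :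
    (∀ (N : Type) [TopologicalSpace N] [T2Space N] [SecondCountableTopology N]
        [ChartedSpace (EuclideanSpace ℝ (Fin 4)) N] [IsManifold (𝓡 4) ∞ N],
        Nonempty (N ≃ₘ⟮𝓡 4, 𝓡 4⟯ Metric.sphere (0 : EuclideanSpace ℝ (Fin 5)) 1) →
        ∀ (e' : EuclideanSpace ℝ (Fin 4) → N) (f' : EuclideanSpace ℝ (Fin 2) → N),
          ¬ MMSW.IsSliceDiscInComplement 1 K N e' f') ↔
      ∀ (e' : EuclideanSpace ℝ (Fin 4) → Metric.sphere (0 : EuclideanSpace ℝ (Fin 5)) 1)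
        (f' : EuclideanSpace ℝ (Fin 2) → Metric.sphere (0 : EuclideanSpace ℝ (Fin 5)) 1),
        ¬ MMSW.IsSliceDiscInComplement 1 K (Metric.sphere (0 : EuclideanSpace ℝ (Fin 5)) 1)
          e' f' := by
  constructor
  · intro h e' f'
    exact h (Metric.sphere (0 : EuclideanSpace ℝ (Fin 5)) 1)
      ⟨Diffeomorph.refl (𝓡 4) (Metric.sphere (0 : EuclideanSpace ℝ (Fin 5)) 1) ∞⟩ e' f'
  · intro h N _ _ _ _ _ hN e' f' hd
    obtain ⟨Φ⟩ := hN
    exact h (Φ ∘ e') (Φ ∘ f') (DcrTransport_proof N Φ 1 e' K f' hd)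

/-- **The item with the literal `S⁴`** (rev-0 shape of the route, recovered): some model knot in
`∂D_1` has a slice datum in the `D_1`-complement of some homotopy `4`-sphere and none in the unit
sphere `S⁴ ⊂ ℝ⁵`, for any smooth chart `e' : ℝ⁴ ↪ S⁴`. Working constructor for a certificate:
`iff_sphereForm.2 ⟨K, hK, hA, hB⟩` from a model knot `hK`, a slice datum `hA` in some homotopy
sphere's `D_1`-complement and the absence `hB` of any datum in the literal `S⁴` (which the route's
engine would get from an MMSW window violation `s₋(K) > 0 ∨ s₊(K) < 0` and the GFGMW lemma at
`k = 1`). [cite: Palais1960, Thm. B] -/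
theorem iff_sphereForm :
    DcrGapOne ↔
      ∃ K : Metric.sphere (0 : EuclideanSpace ℝ (Fin 2)) 1 → EuclideanSpace ℝ (Fin 4),
        MMSW.IsModelKnot 1 K ∧
        (∃ (M : Type) (_ : TopologicalSpace M) (_ : T2Space M) (_ : SecondCountableTopology M)
            (_ : ChartedSpace (EuclideanSpace ℝ (Fin 4)) M) (_ : IsManifold (𝓡 4) ∞ M),
            Nonempty (M ≃ₕ Metric.sphere (0 : EuclideanSpace ℝ (Fin 5)) 1) ∧
              ∃ (e : EuclideanSpace ℝ (Fin 4) → M) (f : EuclideanSpace ℝ (Fin 2) → M),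
                MMSW.IsSliceDiscInComplement 1 K M e f) ∧
        ∀ (e' : EuclideanSpace ℝ (Fin 4) → Metric.sphere (0 : EuclideanSpace ℝ (Fin 5)) 1)
          (f' : EuclideanSpace ℝ (Fin 2) → Metric.sphere (0 : EuclideanSpace ℝ (Fin 5)) 1),
          ¬ MMSW.IsSliceDiscInComplement 1 K (Metric.sphere (0 : EuclideanSpace ℝ (Fin 5)) 1)
            e' f' := by
  rw [iff_model]
  exact exists_congr fun K ↦ and_congr Iff.rfl (and_congr Iff.rfl (noDisc_iff_sphere K))

/-- **The negation unfolded: `k = 1` rigidity.** `¬ DcrGapOne` says exactly: every model knot in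
`∂D_1 ≅ S¹ × S²` that has a slice datum in the `D_1`-complement of SOME smooth homotopy `4`-sphere
has one in the unit sphere `S⁴` — "sliceable in a fake `S² × D²` ⇒ sliceable in `S² × D²`". For
knots inside a `3`-ball of `∂D_1` this specialises to "slice in a homotopy `4`-ball ⇒ slice in `B⁴`"
(the negation of the FGMW waypoint), which is why the negation is open as well.
[cite: ManolescuMarengonSarkarWillis2023, Question 9.11] -/
theorem not_iff_rigidityOne :
    ¬ DcrGapOne ↔
      ∀ K : Metric.sphere (0 : EuclideanSpace ℝ (Fin 2)) 1 → EuclideanSpace ℝ (Fin 4),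
        MMSW.IsModelKnot 1 K →
        ∀ (M : Type) [TopologicalSpace M] [T2Space M] [SecondCountableTopology M]
          [ChartedSpace (EuclideanSpace ℝ (Fin 4)) M] [IsManifold (𝓡 4) ∞ M],
          Nonempty (M ≃ₕ Metric.sphere (0 : EuclideanSpace ℝ (Fin 5)) 1) →
          ∀ (e : EuclideanSpace ℝ (Fin 4) → M) (f : EuclideanSpace ℝ (Fin 2) → M),
            MMSW.IsSliceDiscInComplement 1 K M e f →
            ∃ (e' : EuclideanSpace ℝ (Fin 4) → Metric.sphere (0 : EuclideanSpace ℝ (Fin 5)) 1)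
              (f' : EuclideanSpace ℝ (Fin 2) → Metric.sphere (0 : EuclideanSpace ℝ (Fin 5)) 1),
              MMSW.IsSliceDiscInComplement 1 K
                (Metric.sphere (0 : EuclideanSpace ℝ (Fin 5)) 1) e' f' := by
  rw [iff_sphereForm]
  constructor
  · intro h K hK M _ _ _ _ _ hM e f hA
    by_contra hB
    exact h ⟨K, hK, ⟨M, _, ‹_›, ‹_›, _, ‹_›, hM, e, f, hA⟩, fun e' f' h' ↦ hB ⟨e', f', h'⟩⟩
  · rintro h ⟨K, hK, ⟨M, _, _, _, _, _, hM, e, f, hA⟩, hB⟩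
    obtain ⟨e', f', h'⟩ := h K hK M hM e f hA
    exact hB e' f' h'

end Summit.SmoothPoincare4.SmoothPoincare4.Theorems.DcrGapOne

end
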